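import Summits.QuantumAdvantage.QuantumAdvantage.Theorems.CharDialJLinPeel
import HarnessLib

/-!
# Time reversal of α's u-walk game (decomp-qadv lens-6 g14, tree part 26b)

**`ringWinU_rev`**: reading the input backwards is a symmetry of the game — `WIN_c(y)(u) = WIN_{2c+2n}(yʳ)(uʳ)` with
`uʳ = u ∘ rev`, `yʳ g v = y (rev g) (v ∘ rev)` (the cut at position `g` becomes the cut at `n − g`; the column condition
`c + g + wt + W_{<g} ≢ 0 (3)` is multiplied by `2 = −1`).  On junta ⊕ linear-form data (`JLinData.rev`) the reversal maps
PREFIX counters to SUFFIX counters (`rev_suffix_of_prefix`), keeps juntas' sizes (`card_J_rev`), preserves win counts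
(`winCount_rev`), and maps «positions `j < m` read only by cuts `≥ m`» to «positions `j ≥ n − m` read only by cuts `≤ n − m`»
(`card_pastFree_eq`): the MEMORY face of the one-read prefix residual is the FUTURE face of suffix data (part 26).
WHAT THIS IS NOT: no hardness statement here; separation NOT moved.
-/

namespace Summit.QuantumAdvantage.AdviceFreeQNC0

open Finset

section Rev

variable {n : ℕ}

/-- the reversed strategy: cut `g'` plays what cut `rev g'` played on the reversed input. -/
def yrev (y : Fin (n + 1) → (Fin n → Bool) → Bool) : Fin (n + 1) → (Fin n → Bool) → Bool :=
  fun g v => y (Fin.rev g) (v ∘ Fin.rev)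

/-- CharDialReversal helper `comp_rev_comp_rev` (decomp-qadv land package; see the module docstring). -/
theorem comp_rev_comp_rev (u : Fin n → Bool) : (u ∘ Fin.rev) ∘ Fin.rev = u := by
  funext i; simp [Fin.rev_rev]

/-- CharDialReversal helper `yrev_yrev` (decomp-qadv land package; see the module docstring). -/
theorem yrev_yrev (y : Fin (n + 1) → (Fin n → Bool) → Bool) : yrev (yrev y) = y := by
  funext g v; simp [yrev, Fin.rev_rev, comp_rev_comp_rev]

/-- total weight is reversal invariant. -/
theorem wt_comp_rev (u : Fin n → Bool) : wt (u ∘ Fin.rev) = wt u := by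
  unfold wt
  exact card_equiv Fin.revPerm (fun i => by simp)

/-- prefix weights of the reversed input are suffix weights: `W_{<g}(uʳ) + W_{<n−g}(u) = wt u` (`g ≤ n`). -/
theorem wtPrefix_comp_rev_add (u : Fin n → Bool) {g : ℕ} (hg : g ≤ n) :
    wtPrefix (u ∘ Fin.rev) g + wtPrefix u (n - g) = wt u := by
  have h1 : wtPrefix (u ∘ Fin.rev) g = (univ.filter fun j : Fin n => ¬ j.val < n - g ∧ u j = true).card := by
    unfold wtPrefix
    refine card_equiv Fin.revPerm (fun i => ?_)
    simp only [mem_filter, mem_univ, true_and, Function.comp_apply, Fin.revPerm_apply, Fin.val_rev]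
    constructor
    · rintro ⟨hi, hu⟩; exact ⟨by omega, hu⟩
    · rintro ⟨hi, hu⟩; exact ⟨by omega, hu⟩
  rw [h1]
  unfold wtPrefix wt
  rw [add_comm, ← card_union_of_disjoint]
  · congr 1; ext j
    simp only [mem_union, mem_filter, mem_univ, true_and]
    constructor
    · rintro (⟨_, h⟩ | ⟨_, h⟩) <;> exact h
    · intro h; by_cases hj : j.val < n - g
      · exact Or.inl ⟨hj, h⟩
      · exact Or.inr ⟨hj, h⟩
  · rw [disjoint_filter]
    rintro j _ ⟨h1, _⟩ ⟨h2, _⟩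
    exact h2 h1

/-- the column quantity of the reversed game at cut `n − g` is `−1` times the original one (mod 3). -/
theorem col_rev (c : ℕ) (u : Fin n → Bool) (g : Fin (n + 1)) :
    (((2 * c + 2 * n) + (Fin.rev g).val + walkExp (u ∘ Fin.rev) (Fin.rev g).val : ℕ) : ZMod 3)
      = -(((c + g.val + walkExp u g.val : ℕ) : ZMod 3)) := by
  have hg : g.val ≤ n := Nat.lt_succ_iff.mp g.isLt
  have hrev : (Fin.rev g).val = n - g.val := by rw [Fin.val_rev]; omega
  have hadd := wtPrefix_comp_rev_add u (g := n - g.val) (Nat.sub_le _ _)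
  rw [Nat.sub_sub_self hg] at hadd
  unfold walkExp
  rw [wt_comp_rev, hrev]
  -- cast the ℕ identities
  have e1 : ((wtPrefix (u ∘ Fin.rev) (n - g.val) : ℕ) : ZMod 3) = (wt u : ZMod 3) - (wtPrefix u g.val : ZMod 3) := by
    rw [eq_sub_iff_add_eq, ← Nat.cast_add, hadd]
  have e2 : (((n - g.val : ℕ)) : ZMod 3) = (n : ZMod 3) - (g.val : ZMod 3) := by
    rw [Nat.cast_sub hg]
  push_cast
  rw [e1, e2]
  have h3 : (3 : ZMod 3) = 0 := by decide
  linear_combination ((n : ZMod 3) + c + wt u) * h3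

/-- **TIME REVERSAL**: `WIN_c(y)(u) = WIN_{2c+2n}(yʳ)(uʳ)`. -/
theorem ringWinU_rev (c : ℕ) (y : Fin (n + 1) → (Fin n → Bool) → Bool) (u : Fin n → Bool) :
    ringWinU c y u = ringWinU (2 * c + 2 * n) (yrev y) (u ∘ Fin.rev) := by
  have hmod : ∀ a b : ℕ, ((a : ZMod 3) = -(b : ZMod 3)) → (a % 3 ≠ 0 ↔ b % 3 ≠ 0) := by
    intro a b h
    rw [not_iff_not, ← Nat.dvd_iff_mod_eq_zero, ← Nat.dvd_iff_mod_eq_zero, ← ZMod.natCast_eq_zero_iff,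
      ← ZMod.natCast_eq_zero_iff, h, neg_eq_zero]
  have hc : (univ.filter fun g : Fin (n + 1) => y g u = true ∧ (c + g.val + walkExp u g.val) % 3 ≠ 0).card
      = (univ.filter fun g : Fin (n + 1) => yrev y g (u ∘ Fin.rev) = true ∧
          (2 * c + 2 * n + g.val + walkExp (u ∘ Fin.rev) g.val) % 3 ≠ 0).card := by
    refine card_equiv Fin.revPerm (fun g => ?_)
    simp only [mem_filter, mem_univ, true_and, Fin.revPerm_apply, yrev, Fin.rev_rev, comp_rev_comp_rev]
    rw [hmod _ _ (col_rev c u g)]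
  unfold ringWinU
  rw [hc]

/-- win counts are reversal invariant. -/
theorem card_win_rev (c : ℕ) (y : Fin (n + 1) → (Fin n → Bool) → Bool) :
    (univ.filter fun u : Fin n → Bool => ringWinU c y u = true).card
      = (univ.filter fun u : Fin n → Bool => ringWinU (2 * c + 2 * n) (yrev y) u = true).card := by
  refine card_equiv (Equiv.arrowCongr Fin.revPerm (Equiv.refl Bool)) (fun u => ?_)
  simp only [mem_filter, mem_univ, true_and]
  have e : (Equiv.arrowCongr Fin.revPerm (Equiv.refl Bool)) u = u ∘ Fin.rev := by
    funext i; simp [Equiv.arrowCongr_apply, Fin.revPerm_symm, Fin.revPerm_apply]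
  rw [e, ringWinU_rev c y u]

end Rev

/-! ## Reversal of junta ⊕ linear-form data -/

namespace JLinPeel

open Summit.QuantumAdvantage.AdviceFreeQNC0

variable {p n : ℕ}

/-- the reversed data: cut `g'` = old cut `rev g'` reading the reversed input. -/
def JLinData.rev (D : JLinData p n) : JLinData p n where
  J g := (D.J (Fin.rev g)).map Fin.revPerm.toEmbedding
  a g := D.a (Fin.rev g) ∘ Fin.rev
  h g v s := D.h (Fin.rev g) (v ∘ Fin.rev) s
  hJ g u v huv s := by
    refine D.hJ (Fin.rev g) (u ∘ Fin.rev) (v ∘ Fin.rev) (fun i hi => ?_) s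
    have : Fin.rev i ∈ (D.J (Fin.rev g)).map Fin.revPerm.toEmbedding :=
      mem_map.2 ⟨i, hi, by simp⟩
    simpa using huv (Fin.rev i) this

/-- CharDialReversal helper `mem_J_rev` (decomp-qadv land package; see the module docstring). -/
theorem mem_J_rev (D : JLinData p n) (g : Fin (n + 1)) (j : Fin n) :
    j ∈ D.rev.J g ↔ Fin.rev j ∈ D.J (Fin.rev g) := by
  unfold JLinData.rev
  simp only [mem_map]
  constructor
  · rintro ⟨i, hi, rfl⟩; simpa using hi
  · intro h; exact ⟨Fin.rev j, h, by simp⟩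

/-- CharDialReversal helper `card_J_rev` (decomp-qadv land package; see the module docstring). -/
theorem card_J_rev (D : JLinData p n) (g : Fin (n + 1)) : (D.rev.J g).card = (D.J (Fin.rev g)).card := by
  unfold JLinData.rev; exact card_map _

/-- CharDialReversal helper `form_rev` (decomp-qadv land package; see the module docstring). -/
theorem form_rev (D : JLinData p n) (g : Fin (n + 1)) (v : Fin n → Bool) :
    D.rev.form g v = D.form (Fin.rev g) (v ∘ Fin.rev) := by
  unfold JLinData.form JLinData.rev
  simp only [Function.comp_apply]
  exact Fintype.sum_equiv Fin.revPerm _ _ (fun i => by simp)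

/-- CharDialReversal helper `strat_rev` (decomp-qadv land package; see the module docstring). -/
theorem strat_rev (D : JLinData p n) : D.rev.strat = yrev D.strat := by
  funext g v
  unfold JLinData.strat yrev
  rw [form_rev]; rfl

/-- **win counts are reversal invariant** (charge `c ↦ 2c + 2n`). -/
theorem winCount_rev (D : JLinData p n) (c : ℕ) : winCount (2 * c + 2 * n) D.rev.strat = winCount c D.strat := by
  unfold winCount; rw [strat_rev, ← card_win_rev]

/-- reversal maps PREFIX counters to SUFFIX counters. -/
theorem rev_suffix_of_prefix (D : JLinData p n) (hpre : ∀ g, ∃ t : ZMod p, D.a g = fun i => if i.val < g.val then t else 0)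
    (g : Fin (n + 1)) : ∃ t : ZMod p, D.rev.a g = fun i => if g.val ≤ i.val then t else 0 := by
  obtain ⟨t, ht⟩ := hpre (Fin.rev g)
  refine ⟨t, funext fun i => ?_⟩
  show D.a (Fin.rev g) (Fin.rev i) = _
  rw [ht]
  have hi := i.isLt
  have hg : g.val ≤ n := Nat.lt_succ_iff.mp g.isLt
  simp only [Fin.val_rev]
  by_cases h : g.val ≤ i.val
  · rw [if_pos h, if_pos (by omega)]
  · rw [if_neg h, if_neg (by omega)]

/-- reversal maps SUFFIX counters to PREFIX counters. -/
theorem rev_prefix_of_suffix (D : JLinData p n) (hsuf : ∀ g, ∃ t : ZMod p, D.a g = fun i => if g.val ≤ i.val then t else 0)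
    (g : Fin (n + 1)) : ∃ t : ZMod p, D.rev.a g = fun i => if i.val < g.val then t else 0 := by
  obtain ⟨t, ht⟩ := hsuf (Fin.rev g)
  refine ⟨t, funext fun i => ?_⟩
  show D.a (Fin.rev g) (Fin.rev i) = _
  rw [ht]
  have hi := i.isLt
  have hg : g.val ≤ n := Nat.lt_succ_iff.mp g.isLt
  simp only [Fin.val_rev]
  by_cases h : i.val < g.val
  · rw [if_pos h, if_pos (by omega)]
  · rw [if_neg h, if_neg (by omega)]

/-- CharDialReversal helper `card_J_rev_le` (decomp-qadv land package; see the module docstring). -/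
theorem card_J_rev_le (D : JLinData p n) (hJ1 : ∀ g, (D.J g).card ≤ 1) (g : Fin (n + 1)) : (D.rev.J g).card ≤ 1 := by
  rw [card_J_rev]; exact hJ1 _

/-- the MEMORY structure of `D` at time `m ≤ n` is the FUTURE structure of `D.rev` at time `n − m`. -/
theorem card_pastFree_eq (D : JLinData p n) {m : ℕ} (hm : m ≤ n) :
    (univ.filter fun j : Fin n => j.val < m ∧ ∀ g, j ∈ D.J g → m ≤ g.val).card
      = (univ.filter fun j : Fin n => n - m ≤ j.val ∧ ∀ g, j ∈ D.rev.J g → g.val ≤ n - m).card := by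
  refine card_equiv Fin.revPerm (fun j => ?_)
  simp only [mem_filter, mem_univ, true_and, Fin.revPerm_apply, mem_J_rev, Fin.rev_rev, Fin.val_rev]
  have hj := j.isLt
  constructor
  · rintro ⟨hjm, hread⟩
    refine ⟨by omega, fun g hg => ?_⟩
    have := hread (Fin.rev g) hg
    have hg' : g.val ≤ n := Nat.lt_succ_iff.mp g.isLt
    rw [Fin.val_rev] at this; omega
  · rintro ⟨hjm, hread⟩
    refine ⟨by omega, fun g hg => ?_⟩
    have hg' : g.val ≤ n := Nat.lt_succ_iff.mp g.isLt
    have := hread (Fin.rev g) (by rw [Fin.rev_rev]; exact hg)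
    rw [Fin.val_rev] at this; omega

end JLinPeel

end Summit.QuantumAdvantage.AdviceFreeQNC0
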